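import Summits.Ventures.HSemireg.Pad4TowerLineInertiaLetters

/-!
# Pad4Tower ∕ LineInertia toolkit (2∕2): `X+` on the LINE — the apex-demand clause FIRES (`xplus_fires`) — and the census glue
# `◇_h` + ceiling line ⇒ effective LINE support (HSemireg support file; PT-PORT-2 (a1), tree copy of control's toolkit)

Crux of record: `Summit.HodgeConjecture.HodgeConjecture.Theses.EightfoldBlochSeeds.BlochSeedDiscOne` (item stmt-HodgeConjecture-18881; skeleton
`Cruxes/BlochSeedDiscOne/Lines/birth.lean` 814a6a70c14e831a UNTOUCHED). Nothing in this file proves HC, HC_AV, HC_CM, H2 or item 18881; census-neutral.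
LETTER ALGEBRA on the LINE alphabet of the PAD-4 static game (typed first-order family `Pad4TowerXresFamilies.XPlusClosed`); not about sheaves or seeds.

PROVENANCE. TREE COPY (statements AND proofs verbatim; namespace, docstring, module boundary new) of §4 of `Cruxes/BlochSeedDiscOne/LineInertia.lean`
v6 (plan-lens-HodgeAV-control g8; crux commit 06a81ba2af55, sha16 3b0837875d3109fc) = Part A §4 of `Cruxes/BlochSeedDiscOne/LinePhaseRigidity.lean` v1.9
(control g9; f0ad6d2122a71d9c), plus §C1 «census glue» of the latter (`absCharge_lineLetter`, `isLL_of_diamond_ceiling`, `lsupport_of_diamond_ceiling`).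
Filed on plan-lens-HodgeAV-control g10's KEY (a1) (bus l.10147) by hsemireg-phasetorus-typer-1 g3. §1–§3 are `Pad4TowerLineInertiaLetters` (imported).

CONTENT. §4 `eq_dualPt_dualCell` and **`xplus_fires`**: the apex-demand `X+` clause in the dual world `dualPt 0` — in an effective LINE-`h` support whose
lower level is effective, a present `P`-cell with an apex letter on `f ≠ σ` and the charged LINE letter `(c, k)` on `σ` whose apex hub `P(σ ↦ hI)` is a
present `N`-cell with no lower server on the ray, together with a present `P(σ ↦ (e, k″))`, `k″ ≠ k`, with no lower server, CONTRADICTS `XPlusClosed C`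
((H-e′) letterwise, (H-b)∕W_f vacuous at an apex factor). §C1: `absCharge (lineLetter h c k) = c`; a letter of `◇_h` on the ceiling line is an effective
LINE-`h` letter; `C.InDiamond h` + every letter on `α + c = h` ⇒ `LSupport h C` (the form the kernel certificates `Pad4TowerLineDesignCert8∕10∕12` deliver).
Imports: `Pad4TowerLineInertiaLetters` only. 0 sorry, 0 named facts, no instance ∕ notation ∕ set_option; docstring on every declaration.
-/

namespace Summit.Ventures.HSemireg.Pad4Tower.LineInertia

open Finset Summit.Ventures.HSemireg.Pad4Tower Summit.Ventures.HSemireg.LinePhaseTorus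

/-! ## §4 `X+` on the LINE: the apex-demand clause fires -/

/-- the negated letters of an `N`-cell of `C`, read back: `P′ g = −(N′ g)` with `N′ = dualCell 0 P′`. -/
theorem eq_dualPt_dualCell (P' : MCell) (g : Fin 4) : P' g = dualPt 0 (dualCell 0 P' g) :=
  (dualPt_dualPt 0 (P' g)).symm

/-- **(X⁺-LINE) the apex-demand clause FIRES**: a present `P`-cell `P` with charged letter `(c, k)` on `σ` and an apex letter on `f ≠ σ`,
whose hub partner `P(σ ↦ hI)` is a present `N`-cell with no shallower present `N`-cell `P(σ ↦ (c′, k))`, `1 ≤ c′ < c`, on the own ray,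
and which has a present SIBLING `P(σ ↦ (e, k″))` of another phase `k″ ≠ k` with no present companion `N`-cell `P(σ ↦ (e′, k″))`,
`1 ≤ e′ < e`, violates `X+` (the dual-world `X` clause with `u = k + 2`, `w = k″ + 2`: (H-e′) holds letterwise on the LINE, (H-b) and
`W_f = ∅` are vacuous at an apex demand factor). All `N`-letters effective LINE letters. -/
theorem xplus_fires {h : ℤ} {C : MConfig} (hlow : ∀ N ∈ C.lower, ∀ f, IsLL h (N f)) {P : MCell} (hP : P ∈ C.upper)
    {σ f : Fin 4} (hfσ : f ≠ σ) {c : ℕ} {k : Fin 4} (hσ : P σ = lineLetter h c k) (hc : 1 ≤ c) (hPf : P f = (h, 0, 0))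
    (hN₀ : Function.update P σ (h, 0, 0) ∈ C.lower)
    (htop : ∀ c' : ℕ, 1 ≤ c' → c' < c → Function.update P σ (lineLetter h c' k) ∉ C.lower)
    {e : ℕ} {k'' : Fin 4} (hk'' : k'' ≠ k) (he : 1 ≤ e) (hsib : Function.update P σ (lineLetter h e k'') ∈ C.upper)
    (hcomp : ∀ e' : ℕ, 1 ≤ e' → e' < e → Function.update P σ (lineLetter h e' k'') ∉ C.lower) :
    ¬ XPlusClosed C := by
  intro hX
  have hc1 : (1 : ℤ) ≤ c := by exact_mod_cast hc
  have he1 : (1 : ℤ) ≤ e := by exact_mod_cast he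
  -- the three cells of the clause, in the dual world
  have hZσ : dualCell 0 P σ = dualPt 0 (lineLetter h c k) := by simp only [dualCell, hσ]
  have hZf : dualCell 0 P f = dualPt 0 (h, 0, 0) := by simp only [dualCell, hPf]
  have hqσ : dualCell 0 (Function.update P σ ((h, 0, 0) : BPoint)) σ = dualPt 0 (h, 0, 0) := by
    simp only [dualCell, Function.update_self]
  have hqg : ∀ g, g ≠ σ → dualCell 0 (Function.update P σ ((h, 0, 0) : BPoint)) g = dualCell 0 P g := fun g hg => by
    simp only [dualCell, Function.update_of_ne hg]
  have hnσ : dualCell 0 (Function.update P σ (lineLetter h e k'')) σ = dualPt 0 (lineLetter h e k'') := by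
    simp only [dualCell, Function.update_self]
  have hng : ∀ g, g ≠ σ → dualCell 0 (Function.update P σ (lineLetter h e k'')) g = dualCell 0 P g := fun g hg => by
    simp only [dualCell, Function.update_of_ne hg]
  -- a present dual `P`-cell is the negative of a present `N`-cell; if it agrees with `−P` off `σ` it is `−P(σ ↦ its σ-letter)`
  have hback : ∀ P' ∈ (C.dual 0).upper, (∀ g, g ≠ σ → P' g = dualCell 0 P g) →
      ∀ {x : BPoint}, dualCell 0 P' σ = x → Function.update P σ x ∈ C.lower := by
    intro P' hP' hag x hx
    have hmem := mem_dual_upper.mp hP'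
    have : dualCell 0 P' = Function.update P σ x := by
      funext g
      by_cases hg : g = σ
      · subst hg; rw [Function.update_self, hx]
      · rw [Function.update_of_ne hg]
        show dualPt 0 (P' g) = P g
        rw [hag g hg]
        exact dualPt_dualPt 0 (P g)
    rwa [this] at hmem
  apply hX (dualCell 0 P) (dualCell_mem_dual_lower hP) (dualCell 0 (Function.update P σ ((h, 0, 0) : BPoint)))
    (dualCell_mem_dual_upper hN₀) (dualCell 0 (Function.update P σ (lineLetter h e k''))) (dualCell_mem_dual_lower hsib)
    σ (k + 2) (k'' + 2) f
  refine ⟨?_, hfσ, ⟨fun g hg => hqg g hg, ?_, ?_⟩, ?_, fun hkk => hk'' (add_right_cancel hkk), ⟨fun g hg => ?_, ?_, ?_⟩,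
    ?_, ?_, ?_, ?_⟩
  · -- head letter charged
    rw [hZσ]; fin_cases k <;> simp [lineLetter, isApex] <;> omega
  · rw [hqσ, hZσ]; simp [lineLetter]; omega
  · rw [hqσ, hZσ]
    have : (dualPt 0 (lineLetter h c k)).1 - (dualPt 0 ((h, 0, 0) : BPoint)).1 = c := by simp [lineLetter]
    rw [this]; exact dual_lineLetter h c k
  · -- topmost: a present partner strictly between is a shallower own-ray `N`-cell
    intro P' hP' ⟨hag, hlt, hray⟩
    obtain ⟨c', k₁, -, hN'σ⟩ := hlow _ (mem_dual_upper.mp hP') σ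
    have hP'σ : P' σ = dualPt 0 (lineLetter h c' k₁) := by rw [eq_dualPt_dualCell P' σ, hN'σ]
    rw [hP'σ, hqσ]
    rw [hP'σ, hZσ] at hlt hray
    have hD : (dualPt 0 (lineLetter h c k)).1 - (dualPt 0 (lineLetter h c' k₁)).1 = c - c' := by simp [lineLetter]
    rw [hD] at hray
    simp only [lineLetter] at hlt
    have hlt' : (c' : ℤ) < c := by linarith
    obtain ⟨-, -, hk⟩ := up_classify (d := (c : ℤ) - c') (by linarith) (of_dual_ray hray)
    rcases Nat.eq_zero_or_pos c' with h0 | h0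
    · subst h0; simp [lineLetter]
    · exfalso
      rcases hk with h00 | hk
      · omega
      · subst hk
        exact htop c' h0 (by exact_mod_cast hlt') (hback P' hP' (fun g hg => by rw [hag g hg]) hN'σ)
  · rw [hng g hg, hqg g hg]
  · rw [hqσ, hnσ]; simp [lineLetter]; omega
  · rw [hqσ, hnσ]
    have : (dualPt 0 (lineLetter h e k'')).1 - (dualPt 0 ((h, 0, 0) : BPoint)).1 = e := by simp [lineLetter]
    rw [this]; exact dual_lineLetter h e k''
  · -- no companion: a present `w`-companion strictly between is a shallower `N`-cell on the sibling's ray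
    intro P' hP' hag h1 h2 hray
    obtain ⟨c', k₁, -, hN'σ⟩ := hlow _ (mem_dual_upper.mp hP') σ
    have hP'σ : P' σ = dualPt 0 (lineLetter h c' k₁) := by rw [eq_dualPt_dualCell P' σ, hN'σ]
    rw [hP'σ, hqσ] at h1 hray
    rw [hP'σ, hnσ] at h2
    have hD : (dualPt 0 (lineLetter h c' k₁)).1 - (dualPt 0 ((h, 0, 0) : BPoint)).1 = c' := by simp [lineLetter]
    rw [hD, ← lineLetter_zero h 0] at hray
    simp only [lineLetter] at h1 h2
    have h1' : (1 : ℤ) ≤ c' := by linarith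
    have h2' : (c' : ℤ) < e := by linarith
    obtain ⟨hr, -, -⟩ := up_classify h1' (of_dual_ray hray)
    have hk₁ : k₁ = k'' := (add_right_cancel hr).symm
    subst hk₁
    exact hcomp c' (by exact_mod_cast h1') (by exact_mod_cast h2')
      (hback P' hP' (fun g hg => by rw [hag g hg, hqg g hg]) hN'σ)
  · -- (H-e′): letterwise on the LINE
    intro P' hP' _ _ _ _
    obtain ⟨c', k₁, -, hN'σ⟩ := hlow _ (mem_dual_upper.mp hP') σ
    have hP'σ : P' σ = dualPt 0 (lineLetter h c' k₁) := by rw [eq_dualPt_dualCell P' σ, hN'σ]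
    rw [hP'σ, hqσ]
    have h0 : (0 : ℤ) ≤ c' := by exact_mod_cast Nat.zero_le c'
    fin_cases k₁ <;> simp [lineLetter, Effective]
  · -- (H-b): vacuous, nothing lies strictly null-below the negated apex
    intro P' hP' _ hnull _
    exfalso
    obtain ⟨cf, kf, -, hN'f⟩ := hlow _ (mem_dual_upper.mp hP') f
    have hP'f : P' f = dualPt 0 (lineLetter h cf kf) := by rw [eq_dualPt_dualCell P' f, hN'f]
    have := hnull.1
    rw [hP'f, hZf] at this
    simp [lineLetter] at this
    have h0 : (0 : ℤ) ≤ cf := by exact_mod_cast Nat.zero_le cf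
    linarith
  · -- `W_f = ∅`: vacuous likewise
    intro P' hP' hnull
    exfalso
    obtain ⟨cf, kf, -, hN'f⟩ := hlow _ (mem_dual_upper.mp hP') f
    have hP'f : P' f = dualPt 0 (lineLetter h cf kf) := by rw [eq_dualPt_dualCell P' f, hN'f]
    have := hnull.1
    rw [hP'f, hZf] at this
    simp [lineLetter] at this
    have h0 : (0 : ℤ) ≤ cf := by exact_mod_cast Nat.zero_le cf
    linarith

/-! ## §C1 Census glue: a support in `◇_h` on the ceiling line is an effective LINE-`h` support -/

/-- the census charge `absCharge` of a LINE letter is its charge. -/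
theorem absCharge_lineLetter (h : ℤ) (c : ℕ) (k : Fin 4) : absCharge (lineLetter h c k) = c := by
  have hc : |(c : ℤ)| = c := abs_of_nonneg (by positivity)
  fin_cases k <;> simp [absCharge, chargeOf, lineLetter, hc]

/-- a letter of `◇_h` on the ceiling line `α + c = h` is an effective LINE-`h` letter. -/
theorem isLL_of_diamond_ceiling {h : ℤ} {x : BPoint} (hd : InDiamond h x) (hc : OnCeiling h x) : IsLL h x := by
  obtain ⟨c, k, rfl⟩ := lineLetter_of_axis_ceiling h x hd.1 hc
  refine ⟨c, k, ?_, rfl⟩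
  have h1 := hd.2.1
  rw [absCharge_lineLetter, lineLetter_fst] at h1
  linarith

/-- the census form of `LSupport`: support in `◇_h`, every letter on the ceiling line. -/
theorem lsupport_of_diamond_ceiling {h : ℤ} {C : MConfig} (hd : C.InDiamond h)
    (hc : (∀ Z ∈ C.lower, ∀ f, OnCeiling h (Z f)) ∧ ∀ P ∈ C.upper, ∀ f, OnCeiling h (P f)) : LSupport h C :=
  ⟨fun Z hZ f => isLL_of_diamond_ceiling (hd.1 Z hZ f) (hc.1 Z hZ f),
   fun P hP f => isLL_of_diamond_ceiling (hd.2 P hP f) (hc.2 P hP f)⟩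

end Summit.Ventures.HSemireg.Pad4Tower.LineInertia
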